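import Literature.AlgebraicGeometry.Resolution.CoordinateBlowupProperTransform
import Literature.AlgebraicGeometry.Resolution.Dehomogenization
import Literature.RingTheory.MvPolynomial.IteratedDerivations
import Mathlib.RingTheory.MvPolynomial.Homogeneous
import HarnessLib

/-!
# [OURS · L1 W4.2] The proper transform of a hypersurface on the fibre of a coordinate blow-up chart is the
# dehomogenised initial form (campaign s42 of cell res-hironaka, LADDER-RESOLUTION rung L; support file for the
# hypersurface instance of the informal crux `RidgeConfinement`, stmt-ResolutionOfSingularities-17845, route
# HilbertSamuelElimination; `--supports`, NOT a closing file; companion `…CampaignW42RidgeConfinementHypersurface.lean`)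

HONEST FRAMING. Everything below is OURS (campaign mathematics of slot W4.2 «replace the directrix by Giraud's RIDGE in
CJS Thm. 3.14», prover res-L1-s42-pv-1) and elementary commutative algebra over the TREE's own objects
(`CoordinateBlowupProperTransform.lean`: `coordProperTransform`, `centreOrder`, `centreDegree`, `coordTransformExp`;
`Dehomogenization.lean`: `dehomogenize`; `Literature.RingTheory.MvPolynomial.shift`). NOTHING here is a statement of
H. Hironaka's manuscript [Hironaka2017]; nothing here asserts that any statement of that manuscript holds or fails. AI review
is weaker than expert review.

## Contents

Let `R` be a commutative ring, `f ∈ R[X_σ]`, `D = V(X_i : i ∈ A)` a coordinate centre, `j ∈ A` a chart of the blow-up of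
`𝔸^σ` along `D`, `f_𝔙 = coordProperTransform R A j f` the proper transform (`π^* f = X_j^l f_𝔙`, `l = centreOrder A f`;
the `j`-chart of the blown-up hypersurface `V(f)` is `Spec R[X]/(f_𝔙)`, tree `quotientCoordProperTransformEquiv`).

* `dehomog R j` — dehomogenisation `X_j := 1` keeping the variable set (`= rename val ∘ dehomogenize j`,
  `rename_dehomogenize`); `eq_of_dehomog_eq_of_isHomogeneous` — injective on forms of a fixed degree (tree
  `dehomogenize_ne_zero_of_isHomogeneous`); `map_dehomog`, `totalDegree_dehomog_le`.
* `fibreRestrict R A j` — restriction to the fibre `π⁻¹(0) ∩ {X_j ≠ 0} ≅ 𝔸^{A ∖ j}` of the chart over the origin of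
  the centre (`X_j ↦ 0`, `X_i ↦ 0` for `i ∉ A`); a retraction (`fibreRestrict_fibreRestrict`) commuting with change of
  coefficients and with translations along the fibre (`map_fibreRestrict`, `fibreRestrict_shift`);
  `aeval_congr_of_fibreRestrict_eq` — a polynomial fixed by it involves only `X_i`, `i ∈ A ∖ j`.
* `centreDegree_le_degree`, `centreDegree_lt_degree`, `apply_eq_zero_of_centreDegree_eq_degree`,
  `exists_apply_ne_zero_of_centreDegree_ne_degree` — centre degree versus total degree of a monomial;
  `centreOrder_eq_of_le_of_ne_zero` — `ord_D f ≥ ν` and `(f)_ν ≠ 0` (`ord_0 f ≤ ν`) force `l = ν` (the equimultiple =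
  permissible situation for a hypersurface).
* **`fibreRestrict_coordProperTransform`** — `f_𝔙` restricted to the fibre over the origin is `F(X_j := 1)` for the
  degree-`l` component `F` of `f` (CoP1 (11) «`y_1^{-μ} f ≡ F(1, y_2′, y_3′) mod (y_1′, y_3′)`», here for every
  coordinate centre, every `f`, every commutative ring); `fibreRestrict_dehomog_homogeneousComponent`.

## References (orientation; nothing is cited as a premise)

* V. Cossart, O. Piltant, J. Algebra 320 (2008), proof of Prop. 4.2, (10)–(11).
* Y. Hu, arXiv:2507.21400 (2025), §5 Def. 5.4 — via the tree file `CoordinateBlowupProperTransform.lean`.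
-/

noncomputable section

-- single-conjunct summit: the doubled namespace component `ResolutionOfSingularities` is mandated
set_option linter.dupNamespace false

open MvPolynomial
open Literature.AlgebraicGeometry.Resolution Literature.RingTheory.MvPolynomial

namespace Summit.ResolutionOfSingularities.ResolutionOfSingularities.Theorems

namespace CampaignW42

universe u v w

/-! ## Two substitutions of the chart ring: dehomogenisation `X_j := 1` and restriction to the fibre -/

section Substitutions

variable (R : Type u) [CommRing R] {σ : Type v} [DecidableEq σ] (A : Set σ) (j : σ)

/-- Dehomogenisation in the chart variable, keeping the variable set: `X_j ↦ 1`, `X_i ↦ X_i` (`i ≠ j`)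
(the tree's `Resolution.dehomogenize j` followed by the inclusion of variables, `rename_dehomogenize`).
[folklore] -/
def dehomog : MvPolynomial σ R →ₐ[R] MvPolynomial σ R :=
  aeval fun i => if i = j then 1 else X i

open Classical in
/-- Restriction to the fibre of the `j`-chart over the origin of the centre `V(X_i : i ∈ A)`: `X_j ↦ 0`
(the exceptional divisor), `X_i ↦ 0` for `i ∉ A` (the origin of the centre), `X_i ↦ X_i` for `i ∈ A ∖ j`
(the affine coordinates of `π⁻¹(0) ∩ {X_j ≠ 0} ≅ 𝔸^{A ∖ j}`). [folklore] -/
def fibreRestrict : MvPolynomial σ R →ₐ[R] MvPolynomial σ R :=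
  aeval fun i => if i ∈ A ∧ i ≠ j then X i else 0

/-- `dehomog` on a variable. [folklore] -/
theorem dehomog_X (i : σ) : dehomog R j (X i) = if i = j then 1 else X i :=
  aeval_X _ i

/-- `X_j ↦ 1`. [folklore] -/
@[simp] theorem dehomog_X_self : dehomog R j (X j) = 1 := by
  rw [dehomog_X, if_pos rfl]

/-- `X_i ↦ X_i` for `i ≠ j`. [folklore] -/
@[simp] theorem dehomog_X_of_ne {i : σ} (h : i ≠ j) : dehomog R j (X i) = X i := by
  rw [dehomog_X, if_neg h]

/-- Constants are fixed. [folklore] -/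
@[simp] theorem dehomog_C (c : R) : dehomog R j (C c) = C c := by
  rw [dehomog, algHom_C, MvPolynomial.algebraMap_eq]

open Classical in
/-- `fibreRestrict` on a variable. [folklore] -/
theorem fibreRestrict_X (i : σ) :
    fibreRestrict R A j (X i) = if i ∈ A ∧ i ≠ j then X i else 0 := by
  rw [fibreRestrict, aeval_X]

/-- `X_i ↦ X_i` on the fibre coordinates `i ∈ A ∖ j`. [folklore] -/
@[simp] theorem fibreRestrict_X_of_mem_of_ne {i : σ} (hi : i ∈ A) (hne : i ≠ j) :
    fibreRestrict R A j (X i) = X i := by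
  rw [fibreRestrict_X, if_pos ⟨hi, hne⟩]

/-- `X_j ↦ 0` (the exceptional divisor). [folklore] -/
@[simp] theorem fibreRestrict_X_self : fibreRestrict R A j (X j) = 0 := by
  rw [fibreRestrict_X, if_neg (fun h => h.2 rfl)]

/-- `X_i ↦ 0` for `i ∉ A` (the origin of the centre). [folklore] -/
@[simp] theorem fibreRestrict_X_of_not_mem {i : σ} (hi : i ∉ A) : fibreRestrict R A j (X i) = 0 := by
  rw [fibreRestrict_X, if_neg (fun h => hi h.1)]

/-- Constants are fixed. [folklore] -/
@[simp] theorem fibreRestrict_C (c : R) : fibreRestrict R A j (C c) = C c := by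
  rw [fibreRestrict, algHom_C, MvPolynomial.algebraMap_eq]

/-- The restriction is a retraction: `ρ ∘ ρ = ρ`. [folklore] -/
theorem fibreRestrict_fibreRestrict (p : MvPolynomial σ R) :
    fibreRestrict R A j (fibreRestrict R A j p) = fibreRestrict R A j p := by
  have h : (fibreRestrict R A j).comp (fibreRestrict R A j) = fibreRestrict R A j := by
    refine MvPolynomial.algHom_ext fun i => ?_
    rw [AlgHom.comp_apply]
    by_cases hi : i ∈ A ∧ i ≠ j
    · rw [fibreRestrict_X_of_mem_of_ne R A j hi.1 hi.2, fibreRestrict_X_of_mem_of_ne R A j hi.1 hi.2]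
    · rw [fibreRestrict_X, if_neg hi, map_zero]
  exact AlgHom.congr_fun h p

/-- The tree's dehomogenisation `K[X_σ] → K[X_i : i ≠ j]` followed by the inclusion of variables is `dehomog`.
[folklore] -/
theorem rename_dehomogenize (p : MvPolynomial σ R) :
    rename (Subtype.val : {i : σ // i ≠ j} → σ) (dehomogenize j p) = dehomog R j p := by
  have h : (rename (Subtype.val : {i : σ // i ≠ j} → σ)).comp (dehomogenize (R := R) j) = dehomog R j := by
    refine MvPolynomial.algHom_ext fun i => ?_
    rw [AlgHom.comp_apply, dehomog_X]
    change rename Subtype.val (aeval (killVar j) (X i)) = _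
    rw [aeval_X]
    by_cases hi : i = j
    · subst hi
      rw [killVar_self, map_one, if_pos rfl]
    · rw [killVar_of_ne j hi, rename_X, if_neg hi]
  exact AlgHom.congr_fun h p

/-- **Dehomogenisation is injective on forms of a fixed degree** (from the tree's
`dehomogenize_ne_zero_of_isHomogeneous`). [folklore] -/
theorem eq_of_dehomog_eq_of_isHomogeneous {P Q : MvPolynomial σ R} {n : ℕ} (hP : P.IsHomogeneous n)
    (hQ : Q.IsHomogeneous n) (h : dehomog R j P = dehomog R j Q) : P = Q := by
  by_contra hne
  have h0 : dehomogenize j (P - Q) ≠ 0 :=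
    dehomogenize_ne_zero_of_isHomogeneous j (hP.sub hQ) (sub_ne_zero.mpr hne)
  apply h0
  apply rename_injective (Subtype.val : {i : σ // i ≠ j} → σ) Subtype.val_injective
  rw [rename_dehomogenize, map_sub, h, sub_self, map_zero]

/-- A polynomial fixed by the fibre restriction involves only the variables `X_i`, `i ∈ A ∖ j`: two
substitutions agreeing there agree on it. [folklore] -/
theorem aeval_congr_of_fibreRestrict_eq {S : Type w} [CommRing S] [Algebra R S] {p : MvPolynomial σ R}
    (hp : fibreRestrict R A j p = p) {φ ψ : σ → S} (h : ∀ i ∈ A, i ≠ j → φ i = ψ i) :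
    aeval φ p = aeval ψ p := by
  classical
  have key : ∀ χ : σ → S, aeval χ p = aeval (fun i => if i ∈ A ∧ i ≠ j then χ i else 0) p := by
    intro χ
    conv_lhs => rw [← hp]
    rw [← AlgHom.comp_apply, fibreRestrict, comp_aeval]
    have hfun : (fun i => aeval χ (if i ∈ A ∧ i ≠ j then (X i : MvPolynomial σ R) else 0)) =
        fun i => if i ∈ A ∧ i ≠ j then χ i else 0 := by
      funext i
      by_cases hi : i ∈ A ∧ i ≠ j
      · rw [if_pos hi, if_pos hi, aeval_X]
      · rw [if_neg hi, if_neg hi, map_zero]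
    rw [hfun]
  have hφψ : (fun i => if i ∈ A ∧ i ≠ j then φ i else 0) = fun i => if i ∈ A ∧ i ≠ j then ψ i else 0 := by
    funext i
    by_cases hi : i ∈ A ∧ i ≠ j
    · rw [if_pos hi, if_pos hi, h i hi.1 hi.2]
    · rw [if_neg hi, if_neg hi]
  rw [key φ, key ψ, hφψ]

/-- The fibre restriction commutes with change of coefficients. [folklore] -/
theorem map_fibreRestrict {S : Type w} [CommRing S] (φ : R →+* S) (p : MvPolynomial σ R) :
    map φ (fibreRestrict R A j p) = fibreRestrict S A j (map φ p) := by
  have h : (map φ).comp (fibreRestrict R A j).toRingHom = (fibreRestrict S A j).toRingHom.comp (map φ) := by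
    refine MvPolynomial.ringHom_ext (fun c => ?_) (fun i => ?_)
    · simp only [RingHom.comp_apply, AlgHom.toRingHom_eq_coe, AlgHom.coe_toRingHom, fibreRestrict_C, map_C]
    · simp only [RingHom.comp_apply, AlgHom.toRingHom_eq_coe, AlgHom.coe_toRingHom, map_X]
      by_cases hi : i ∈ A ∧ i ≠ j
      · rw [fibreRestrict_X_of_mem_of_ne R A j hi.1 hi.2, fibreRestrict_X_of_mem_of_ne S A j hi.1 hi.2, map_X]
      · rw [fibreRestrict_X, if_neg hi, fibreRestrict_X, if_neg hi, map_zero]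
  exact RingHom.congr_fun h p

/-- Dehomogenisation commutes with change of coefficients. [folklore] -/
theorem map_dehomog {S : Type w} [CommRing S] (φ : R →+* S) (p : MvPolynomial σ R) :
    map φ (dehomog R j p) = dehomog S j (map φ p) := by
  have h : (map φ).comp (dehomog R j).toRingHom = (dehomog S j).toRingHom.comp (map φ) := by
    refine MvPolynomial.ringHom_ext (fun c => ?_) (fun i => ?_)
    · simp only [RingHom.comp_apply, AlgHom.toRingHom_eq_coe, AlgHom.coe_toRingHom, dehomog_C, map_C]
    · simp only [RingHom.comp_apply, AlgHom.toRingHom_eq_coe, AlgHom.coe_toRingHom, map_X]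
      by_cases hi : i = j
      · subst hi
        rw [dehomog_X_self, dehomog_X_self, map_one]
      · rw [dehomog_X_of_ne R j hi, dehomog_X_of_ne S j hi, map_X]
  exact RingHom.congr_fun h p

/-- The fibre restriction commutes with the translation by a vector `b` of the fibre (`b_j = 0`, `b_i = 0` for
`i ∉ A`). [folklore] -/
theorem fibreRestrict_shift (b : σ → R) (hbj : b j = 0) (hbA : ∀ i ∉ A, b i = 0) (p : MvPolynomial σ R) :
    fibreRestrict R A j (shift b p) = shift b (fibreRestrict R A j p) := by
  have h : (fibreRestrict R A j).comp (shift b) = (shift b).comp (fibreRestrict R A j) := by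
    refine MvPolynomial.algHom_ext fun i => ?_
    rw [AlgHom.comp_apply, AlgHom.comp_apply, shift_X, map_add, fibreRestrict_C]
    by_cases hi : i ∈ A ∧ i ≠ j
    · rw [fibreRestrict_X_of_mem_of_ne R A j hi.1 hi.2, shift_X]
    · rw [fibreRestrict_X, if_neg hi, map_zero, zero_add]
      have hb : b i = 0 := by
        by_cases hiA : i ∈ A
        · have hij : i = j := by
            by_contra hij
            exact hi ⟨hiA, hij⟩
          rw [hij, hbj]
        · exact hbA i hiA
      rw [hb, C_0]
  exact AlgHom.congr_fun h p

/-- The total degree does not increase under dehomogenisation. [folklore] -/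
theorem totalDegree_dehomog_le [Nontrivial R] (p : MvPolynomial σ R) :
    (dehomog R j p).totalDegree ≤ p.totalDegree :=
  totalDegree_aeval_le_of_le_one _ (fun i => by
    by_cases hi : i = j
    · rw [if_pos hi, totalDegree_one]; exact Nat.zero_le _
    · rw [if_neg hi, totalDegree_X]) p

end Substitutions

/-! ## Centre degrees versus total degrees -/

section CentreDegree

variable {σ : Type v} (A : Set σ)

/-- `m_A(d) = Σ_{i ∈ supp d} d_i · [i ∈ A]`. [folklore] -/
theorem centreDegree_eq_sum (d : σ →₀ ℕ) :
    centreDegree A d = ∑ i ∈ d.support, d i * centreWeight A i := by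
  rw [centreDegree, Finsupp.weight_apply, Finsupp.sum]
  rfl

/-- The degree in the centre variables is at most the total degree. [folklore] -/
theorem centreDegree_le_degree (d : σ →₀ ℕ) : centreDegree A d ≤ d.degree := by
  rw [centreDegree_eq_sum, Finsupp.degree_apply]
  refine Finset.sum_le_sum fun i _ => ?_
  by_cases hi : i ∈ A
  · rw [centreWeight_of_mem A hi, mul_one]
  · rw [centreWeight_of_not_mem A hi, mul_zero]; exact Nat.zero_le _

/-- A monomial with a variable off the centre has centre degree strictly below its degree. [folklore] -/
theorem centreDegree_lt_degree {d : σ →₀ ℕ} {i : σ} (hiA : i ∉ A) (hi : d i ≠ 0) :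
    centreDegree A d < d.degree := by
  rw [centreDegree_eq_sum, Finsupp.degree_apply]
  refine Finset.sum_lt_sum (fun k _ => ?_) ⟨i, Finsupp.mem_support_iff.mpr hi, ?_⟩
  · by_cases hk : k ∈ A
    · rw [centreWeight_of_mem A hk, mul_one]
    · rw [centreWeight_of_not_mem A hk, mul_zero]; exact Nat.zero_le _
  · rw [centreWeight_of_not_mem A hiA, mul_zero]
    exact Nat.pos_of_ne_zero hi

/-- If the centre degree is the total degree, the monomial involves centre variables only. [folklore] -/
theorem apply_eq_zero_of_centreDegree_eq_degree {d : σ →₀ ℕ} (h : centreDegree A d = d.degree) {i : σ}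
    (hiA : i ∉ A) : d i = 0 := by
  by_contra hi
  exact (centreDegree_lt_degree A hiA hi).ne h

/-- If the centre degree is NOT the total degree, some variable off the centre occurs. [folklore] -/
theorem exists_apply_ne_zero_of_centreDegree_ne_degree {d : σ →₀ ℕ} (h : centreDegree A d ≠ d.degree) :
    ∃ i, i ∉ A ∧ d i ≠ 0 := by
  by_contra hall
  push Not at hall
  apply h
  rw [centreDegree_eq_sum, Finsupp.degree_apply]
  refine Finset.sum_congr rfl fun i hi => ?_
  have hiA : i ∈ A := by
    by_contra hiA
    exact (Finsupp.mem_support_iff.mp hi) (hall i hiA)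
  rw [centreWeight_of_mem A hiA, mul_one]

/-- **Permissibility pins the exponent**: if every monomial of `f` has centre degree `≥ ν` (`ord_D f ≥ ν`) and the
degree-`ν` component of `f` is non-zero (`ord_0 f ≤ ν`), then `centreOrder A f = ν` (`= ord_D f = ord_0 f`).
[folklore] -/
theorem centreOrder_eq_of_le_of_ne_zero {R : Type u} [CommRing R] {f : MvPolynomial σ R} {ν : ℕ}
    (hperm : ∀ d ∈ f.support, ν ≤ centreDegree A d) (hord : homogeneousComponent ν f ≠ 0) :
    centreOrder A f = ν := by
  classical
  have hf : f ≠ 0 := by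
    rintro rfl
    exact hord (by rw [homogeneousComponent_apply, support_zero, Finset.filter_empty, Finset.sum_empty])
  refine le_antisymm ?_ (le_centreOrder R A hf hperm)
  obtain ⟨d, hd⟩ := MvPolynomial.ne_zero_iff.mp hord
  rw [coeff_homogeneousComponent] at hd
  split_ifs at hd with hdeg
  · exact (centreOrder_le R A (mem_support_iff.mpr hd)).trans ((centreDegree_le_degree A d).trans hdeg.le)
  · exact absurd rfl hd

end CentreDegree

/-! ## The proper transform restricted to the fibre is the dehomogenised initial form -/

section Fibre

variable (R : Type u) [CommRing R] {σ : Type v} [DecidableEq σ] (A : Set σ) {j : σ}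

/-- One term: the transformed monomial `X^{d'}`, `d' = d ∖ X_j + (m_A(d) − l)·X_j`, restricts to the fibre as the
dehomogenised monomial `X^d(X_j := 1)` if `|d| = l`, and to `0` otherwise (for `m_A(d) ≥ l`). [folklore] -/
theorem fibreRestrict_monomial_coordTransformExp (hj : j ∈ A) {l : ℕ} {d : σ →₀ ℕ} (hd : l ≤ centreDegree A d)
    (c : R) :
    fibreRestrict R A j (monomial (coordTransformExp A j l d) c) =
      if d.degree = l then dehomog R j (monomial d c) else 0 := by
  classical
  have hcd : centreDegree A d ≤ d.degree := centreDegree_le_degree A d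
  rw [fibreRestrict, aeval_monomial]
  split_ifs with hdeg
  · -- `|d| = l`: then `m_A(d) = l` and `d` involves centre variables only
    rw [dehomog, aeval_monomial]
    have hc : centreDegree A d = l := le_antisymm (hdeg ▸ hcd) hd
    have hoff : ∀ i ∉ A, d i = 0 := fun i hi =>
      apply_eq_zero_of_centreDegree_eq_degree A (hc.trans hdeg.symm) hi
    congr 1
    have hsub : (coordTransformExp A j l d).support ⊆ insert j d.support := by
      intro i hi
      rw [Finset.mem_insert]
      by_cases hij : i = j
      · exact Or.inl hij
      · right
        rw [Finsupp.mem_support_iff] at hi ⊢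
        rwa [coordTransformExp_apply_of_ne A j l d hij] at hi
    rw [Finsupp.prod_of_support_subset _ hsub _ (fun _ _ => pow_zero _),
      Finsupp.prod_of_support_subset d (Finset.subset_insert j d.support) _ (fun _ _ => pow_zero _)]
    refine Finset.prod_congr rfl fun i hi => ?_
    by_cases hij : i = j
    · subst hij
      rw [coordTransformExp_apply_self, hc, Nat.sub_self, pow_zero, if_pos rfl, one_pow]
    · rw [coordTransformExp_apply_of_ne A j l d hij, if_neg hij]
      have hid : i ∈ d.support := (Finset.mem_insert.mp hi).resolve_left hij
      have hiA : i ∈ A := by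
        by_contra hiA
        exact (Finsupp.mem_support_iff.mp hid) (hoff i hiA)
      rw [if_pos ⟨hiA, hij⟩]
  · -- `|d| ≠ l`: a factor of the restricted monomial vanishes
    rcases lt_or_eq_of_le hd with hlt | heq
    · -- `m_A(d) > l`: the exceptional variable survives in `X^{d'}` and is killed
      have hj' : j ∈ (coordTransformExp A j l d).support := by
        rw [Finsupp.mem_support_iff, coordTransformExp_apply_self]
        omega
      rw [Finsupp.prod, Finset.prod_eq_zero hj' ?_, mul_zero]
      rw [coordTransformExp_apply_self, if_neg (fun h => h.2 rfl)]
      exact zero_pow (by omega)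
    · -- `m_A(d) = l < |d|`: a variable off the centre survives and is killed
      have hne : centreDegree A d ≠ d.degree := by omega
      obtain ⟨i, hiA, hi⟩ := exists_apply_ne_zero_of_centreDegree_ne_degree A hne
      have hij : i ≠ j := fun h => hiA (h ▸ hj)
      have hi' : i ∈ (coordTransformExp A j l d).support := by
        rw [Finsupp.mem_support_iff, coordTransformExp_apply_of_ne A j l d hij]
        exact hi
      rw [Finsupp.prod, Finset.prod_eq_zero hi' ?_, mul_zero]
      rw [coordTransformExp_apply_of_ne A j l d hij, if_neg (fun h => hiA h.1)]
      exact zero_pow hi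

/-- **The proper transform on the fibre over the origin is the dehomogenised initial form**: restricting
`f_𝔙 = coordProperTransform R A j f` to `π⁻¹(0) ∩ {X_j ≠ 0}` (`X_j := 0`, `X_i := 0` for `i ∉ A`) gives
`F(X_j := 1)` for the degree-`l` component `F` of `f`, `l = centreOrder A f` (CoP1 (11):
"`y_1^{-μ} f ≡ F(1, y_2′, y_3′) mod (y_1′, y_3′)`"; here for every coordinate centre and every `f`). [folklore] -/
theorem fibreRestrict_coordProperTransform (hj : j ∈ A) (f : MvPolynomial σ R) :
    fibreRestrict R A j (coordProperTransform R A j f) =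
      dehomog R j (homogeneousComponent (centreOrder A f) f) := by
  classical
  rw [coordProperTransform, map_sum, homogeneousComponent_apply, map_sum, Finset.sum_filter]
  exact Finset.sum_congr rfl fun d hd =>
    fibreRestrict_monomial_coordTransformExp R A hj (centreOrder_le R A hd) (coeff d f)

/-- The dehomogenised initial form involves only the fibre variables `X_i`, `i ∈ A ∖ j`. [folklore] -/
theorem fibreRestrict_dehomog_homogeneousComponent (hj : j ∈ A) (f : MvPolynomial σ R) :
    fibreRestrict R A j (dehomog R j (homogeneousComponent (centreOrder A f) f)) =
      dehomog R j (homogeneousComponent (centreOrder A f) f) := by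
  rw [← fibreRestrict_coordProperTransform R A hj f, fibreRestrict_fibreRestrict]

end Fibre

end CampaignW42

end Summit.ResolutionOfSingularities.ResolutionOfSingularities.Theorems

end
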